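import Summits.AtomisticToContinuum.BoseEinsteinCondensation.Theses.BECSwapNoCatastrophe
import Summits.AtomisticToContinuum.BoseEinsteinCondensation.Theorems.BECSwapNoCatastropheSwapToZeroModeNonneg
import Summits.AtomisticToContinuum.BoseEinsteinCondensation.Theorems.BECSwapNoCatastropheSwapToZeroModeStability
import Summits.AtomisticToContinuum.BoseEinsteinCondensation.Theorems.BECSwapNoCatastropheSwapToZeroModeAverage
import Literature.MathematicalPhysics.QuantumManyBody.CondensateOccupationStability
import Literature.MathematicalPhysics.QuantumManyBody.PeriodicBoseGasImpurityTranslation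
import Literature.MathematicalPhysics.QuantumManyBody.BoseGasMergeOccupation

/-!
# Route `BECSwapNoCatastrophe` — support item `SwapToZeroMode` (stmt-AtomisticToContinuum-14397)

Closes `Summit.AtomisticToContinuum.BoseEinsteinCondensation.Theses.BECSwapNoCatastrophe.SwapToZeroMode`:
`TorusPhaseRigidity → TorusSwapBound → PeriodicBEC` (constant-mode occupation `≥ cN` for periodic
`δ`-near-minimisers on the torus of side `(N/ρ)^{1/3}`), i.e. mode-free condensation (swap purity
`tr γ²/N² ≥ c_X`) plus fixed-`N` phase rigidity give condensation IN THE CONSTANT MODE.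

Proof (the planner's four steps, Fourier-free). Fix `v`, `ρ < min ρ₀`, `N = n+1` large, `L = (N/ρ)^{1/3}`,
`c_X, δ_X` from `TorusSwapBound`, and `δ_R(η)` from `TorusPhaseRigidity` with `η = (√c_X/4)²`.
1. At every slack there is a NON-NEGATIVE near-minimiser `Φ ≥ 0`
   (`SwapToZeroMode.exists_nonneg_nearMinimiser`, diamagnetic smoothing).
2. Its translates `Φ(· + s𝟙)` are near-minimisers (`periodicEnergy_translate`), so rigidity gives
   `∫_{cell^N} |Φ - c_s Φ(· + s𝟙)|² ≤ η` with `|c_s| = 1`, for every `s ∈ ℝ³`.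
3. For every normalised mode `u`: `occ(u, 1Φ)^{1/2} ≤ occ(u, 1Φ(·+s𝟙))^{1/2} + √(Nη)`
   (`SwapToZeroMode.occupation_rpow_half_le_add`), and the `s`-average over the cell of
   `occ(u, 1Φ(·+s𝟙))` is `≤ ⟨Φ, n₀Φ⟩` (`SwapToZeroMode.lintegral_occupation_translate_le`, positivity of
   `Φ`); hence `λ_max(γ_{1Φ}) ≤ (n₀^{1/2} + √(Nη))²` (`maxOccupation_indicator_le`), and with
   Penrose–Onsager II `N · swapPurity ≤ λ_max` (`succ_mul_swapPurity_le_maxOccupation`) and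
   `swapPurity ≥ c_X`: `n₀(Φ) ≥ N c_X/2`.
4. Near-minimisers cluster modulo a phase (rigidity again), and `n₀` is `2N`-Lipschitz on the unit ball,
   so EVERY `δ`-near-minimiser has `n₀ ≥ N c_X/4`
   (`le_condensateOccupation_nearMinimiser_of_clustering`).
-/

noncomputable section

namespace Summit.AtomisticToContinuum.BoseEinsteinCondensation.Theorems

open MeasureTheory Filter
open scoped ENNReal NNReal ComplexConjugate
open Literature.MathematicalPhysics.QuantumManyBody.BoseGas

namespace SwapToZeroMode

variable {n : ℕ} {L : ℝ}

/-- `∫ |1_{cell^N} f - c 1_{cell^N} g|² = ∫_{cell^N} |f - c g|²`. [folklore] -/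
theorem lintegral_indicator_sub_sq (N : ℕ) (L : ℝ) (f g : Config N → ℂ) (c : ℂ) :
    ∫⁻ X, (‖(cellN N L).indicator f X - c * (cellN N L).indicator g X‖₊ : ℝ≥0∞) ^ 2 =
      ∫⁻ X in cellN N L, (‖f X - c * g X‖₊ : ℝ≥0∞) ^ 2 := by
  rw [← lintegral_indicator (measurableSet_cellN N L)]
  congr 1
  funext X
  by_cases hX : X ∈ cellN N L <;> simp [hX]

/-- `∫ |1_{cell^N} f|² = ∫_{cell^N} |f|²`. [folklore] -/
theorem lintegral_indicator_sq (N : ℕ) (L : ℝ) (f : Config N → ℂ) :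
    ∫⁻ X, (‖(cellN N L).indicator f X‖₊ : ℝ≥0∞) ^ 2 = ∫⁻ X in cellN N L, (‖f X‖₊ : ℝ≥0∞) ^ 2 := by
  rw [← lintegral_indicator (measurableSet_cellN N L)]
  congr 1
  funext X
  by_cases hX : X ∈ cellN N L <;> simp [hX]

/-- **The zero mode carries the top eigenvalue, up to the rigidity defect.** For a non-negative
periodic state `Φ ≥ 0` of `n+1` bosons on the torus of side `L > 0` whose translates are `η`-close to
`Φ` modulo a phase (`∫_{cell^N} |Φ - c_s Φ(· + s𝟙)|² ≤ η`, `|c_s| = 1`, all `s`):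
`λ_max(γ_{1_{cell^N}Φ}) ≤ (⟨Φ, n₀Φ⟩^{1/2} + (Nη)^{1/2})²`. For an exactly translation-invariant
positive state this is `λ_max = n₀` (the translation-averaged density matrix is convolution by a
non-negative kernel, maximal on the constant); here: occupation stability in the state, the bound on
translation averages `lintegral_occupation_translate_le`, and `λ_max = sup` over modes
(which see the mode only a.e., `occupation_congr_ae`).
[cite: PenroseOnsager1956, §4 (5)–(7)] -/
theorem maxOccupation_indicator_le (hL : 0 < L) (Φ : PeriodicTrialState (n + 1) L)
    (hreal : ∀ X, Φ.ψ X = (‖Φ.ψ X‖ : ℂ)) {η : ℝ≥0∞}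
    (hrig : ∀ s : Space, ∃ c : ℂ, ‖c‖ = 1 ∧
      ∫⁻ X in cellN (n + 1) L, (‖Φ.ψ X - c * Φ.ψ (X + fun _ => s)‖₊ : ℝ≥0∞) ^ 2 ≤ η) :
    maxOccupation (n + 1) ((cellN (n + 1) L).indicator Φ.ψ) ≤
      (condensateOccupation (n + 1) L Φ.ψ ^ (1 / 2 : ℝ) +
        ((n + 1 : ℕ) : ℝ≥0∞) ^ (1 / 2 : ℝ) * η ^ (1 / 2 : ℝ)) ^ 2 := by
  set n₀ := condensateOccupation (n + 1) L Φ.ψ with hn₀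
  set b : ℝ≥0∞ := ((n + 1 : ℕ) : ℝ≥0∞) ^ (1 / 2 : ℝ) * η ^ (1 / 2 : ℝ) with hb
  have hL3 : ENNReal.ofReal L ^ 3 ≠ 0 := pow_ne_zero _ (by simpa using hL)
  have hL3' : ENNReal.ofReal L ^ 3 ≠ ⊤ := ENNReal.pow_ne_top ENNReal.ofReal_ne_top
  have hsq : ∀ y : ℝ≥0∞, (y ^ (1 / 2 : ℝ)) ^ 2 = y := fun y => by
    rw [← ENNReal.rpow_two, ← ENNReal.rpow_mul]
    norm_num
  have hsq' : ∀ y : ℝ≥0∞, (y ^ 2) ^ (1 / 2 : ℝ) = y := fun y => by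
    rw [← ENNReal.rpow_two, ← ENNReal.rpow_mul]
    norm_num
  have hΦm : Measurable ((cellN (n + 1) L).indicator Φ.ψ) :=
    Φ.contDiff.continuous.measurable.indicator (measurableSet_cellN _ _)
  have hΦsm : ∀ s : Space,
      Measurable ((cellN (n + 1) L).indicator fun X => Φ.ψ (X + fun _ => s)) := fun s =>
    (Φ.contDiff.continuous.comp (continuous_id.add continuous_const)).measurable.indicator
      (measurableSet_cellN _ _)
  refine iSup₂_le fun φ hφ => ?_
  obtain ⟨hφm, hφ1⟩ := hφ
  -- a measurable modification of the mode
  have hφ'm : Measurable (hφm.mk φ) := hφm.stronglyMeasurable_mk.measurable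
  have hae : φ =ᵐ[volume] hφm.mk φ := hφm.ae_eq_mk
  have hφ'1 : ∫⁻ x, (‖hφm.mk φ x‖₊ : ℝ≥0∞) ^ 2 = 1 := by
    rw [← hφ1]
    refine lintegral_congr_ae ?_
    filter_upwards [hae] with x hx
    rw [hx]
  rw [occupation_congr_ae hae]
  set a := occupation (n + 1) (hφm.mk φ) ((cellN (n + 1) L).indicator Φ.ψ) with ha
  -- for every translation: `(a^{1/2} - b)² ≤ occ(u, 1Φ(· + s𝟙))`
  have hs : ∀ s : Space, (a ^ (1 / 2 : ℝ) - b) ^ 2 ≤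
      occupation (n + 1) (hφm.mk φ) ((cellN (n + 1) L).indicator fun X => Φ.ψ (X + fun _ => s)) := by
    intro s
    obtain ⟨c, hc, hcs⟩ := hrig s
    have hst := occupation_rpow_half_le_add hφ'm.aestronglyMeasurable hφ'1 hΦm (hΦsm s) hc
    rw [lintegral_indicator_sub_sq] at hst
    have h1 : a ^ (1 / 2 : ℝ) ≤ occupation (n + 1) (hφm.mk φ)
        ((cellN (n + 1) L).indicator fun X => Φ.ψ (X + fun _ => s)) ^ (1 / 2 : ℝ) + b := by
      refine hst.trans (add_le_add le_rfl ?_)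
      rw [hb]
      gcongr
    have h2 := tsub_le_iff_right.2 h1
    calc (a ^ (1 / 2 : ℝ) - b) ^ 2
        ≤ (occupation (n + 1) (hφm.mk φ)
            ((cellN (n + 1) L).indicator fun X => Φ.ψ (X + fun _ => s)) ^ (1 / 2 : ℝ)) ^ 2 := by
          gcongr
      _ = _ := hsq _
  -- average over the cell of translations
  have hint : (a ^ (1 / 2 : ℝ) - b) ^ 2 * ENNReal.ofReal L ^ 3 ≤ ENNReal.ofReal L ^ 3 * n₀ := by
    calc (a ^ (1 / 2 : ℝ) - b) ^ 2 * ENNReal.ofReal L ^ 3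
        = ∫⁻ _ in cell L, (a ^ (1 / 2 : ℝ) - b) ^ 2 := by rw [setLIntegral_const, volume_cell]
      _ ≤ ∫⁻ s in cell L, occupation (n + 1) (hφm.mk φ)
            ((cellN (n + 1) L).indicator fun X => Φ.ψ (X + fun _ => s)) :=
          lintegral_mono fun s => hs s
      _ ≤ ENNReal.ofReal L ^ 3 * n₀ := lintegral_occupation_translate_le hL Φ hreal hφ'm hφ'1.le
  have hint' : (a ^ (1 / 2 : ℝ) - b) ^ 2 ≤ n₀ := by
    rw [mul_comm] at hint
    exact (ENNReal.mul_le_mul_iff_right hL3 hL3').1 hint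
  -- undo the square and the subtraction
  have h3 : a ^ (1 / 2 : ℝ) - b ≤ n₀ ^ (1 / 2 : ℝ) := by
    calc a ^ (1 / 2 : ℝ) - b = (((a ^ (1 / 2 : ℝ) - b)) ^ 2) ^ (1 / 2 : ℝ) := (hsq' _).symm
      _ ≤ n₀ ^ (1 / 2 : ℝ) := ENNReal.rpow_le_rpow hint' (by norm_num)
  have h4 : a ^ (1 / 2 : ℝ) ≤ n₀ ^ (1 / 2 : ℝ) + b := tsub_le_iff_right.1 h3
  calc a = (a ^ (1 / 2 : ℝ)) ^ 2 := (hsq a).symm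
    _ ≤ (n₀ ^ (1 / 2 : ℝ) + b) ^ 2 := by gcongr

/-- **Swap bound + rigidity ⇒ a condensed non-negative near-minimiser at every slack** (fixed `N = n+1`,
`L > 0`, measurable `v`). If all pairs of `δ_R`-near-minimisers are `η`-close modulo a phase with
`η = (√c_X/4)²`, and all `δ_X`-near-minimisers have swap purity `≥ c_X`, then for every `δ > 0` some
`δ`-near-minimiser `Φ ≥ 0` has `⟨Φ, n₀Φ⟩ ≥ N c_X/2`. [cite: PenroseOnsager1956, §4 (5)–(7)] -/
theorem exists_nearMinimiser_condensateOccupation_ge (hL : 0 < L) {v : ℝ → ℝ≥0∞}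
    (hv : Measurable v) {cX : ℝ} (hcX : 0 < cX) {δR δX : ℝ≥0∞} (hδR : 0 < δR) (hδX : 0 < δX)
    (hR : ∀ Ψ Φ : PeriodicTrialState (n + 1) L,
      periodicEnergy v Ψ ≤ periodicGroundStateEnergy v (n + 1) L + δR →
      periodicEnergy v Φ ≤ periodicGroundStateEnergy v (n + 1) L + δR →
      ∃ c : ℂ, ‖c‖ = 1 ∧ ∫⁻ X in cellN (n + 1) L, (‖Ψ.ψ X - c * Φ.ψ X‖₊ : ℝ≥0∞) ^ 2 ≤
        ENNReal.ofReal ((Real.sqrt cX / 4) ^ 2))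
    (hX : ∀ Ψ : PeriodicTrialState (n + 1) L,
      periodicEnergy v Ψ ≤ periodicGroundStateEnergy v (n + 1) L + δX →
      ENNReal.ofReal cX ≤ swapPurity n ((cellN (n + 1) L).indicator Ψ.ψ))
    (Ψ₀ : PeriodicTrialState (n + 1) L) {δ : ℝ≥0∞} (hδ : 0 < δ) :
    ∃ Φ : PeriodicTrialState (n + 1) L,
      periodicEnergy v Φ ≤ periodicGroundStateEnergy v (n + 1) L + δ ∧
      ENNReal.ofReal (cX / 2 * ((n + 1 : ℕ) : ℝ)) ≤ condensateOccupation (n + 1) L Φ.ψ := by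
  set E₀ := periodicGroundStateEnergy v (n + 1) L with hE₀
  set η : ℝ := (Real.sqrt cX / 4) ^ 2 with hη
  -- Step 1: a non-negative near-minimiser at the slack `min δ (min δR δX)`
  have hδ' : 0 < min δ (min δR δX) := lt_min hδ (lt_min hδR hδX)
  obtain ⟨Φ, hΦE, hreal⟩ := exists_nonneg_nearMinimiser hv Ψ₀ hδ'
  have hΦδ : periodicEnergy v Φ ≤ E₀ + δ := hΦE.trans (add_le_add le_rfl (min_le_left _ _))
  have hΦR : periodicEnergy v Φ ≤ E₀ + δR :=
    hΦE.trans (add_le_add le_rfl ((min_le_right _ _).trans (min_le_left _ _)))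
  have hΦX : periodicEnergy v Φ ≤ E₀ + δX :=
    hΦE.trans (add_le_add le_rfl ((min_le_right _ _).trans (min_le_right _ _)))
  refine ⟨Φ, hΦδ, ?_⟩
  -- Step 2: translates are near-minimisers, hence close to `Φ` modulo a phase
  have hrig : ∀ s : Space, ∃ c : ℂ, ‖c‖ = 1 ∧
      ∫⁻ X in cellN (n + 1) L, (‖Φ.ψ X - c * Φ.ψ (X + fun _ => s)‖₊ : ℝ≥0∞) ^ 2 ≤
        ENNReal.ofReal η := by
    intro s
    obtain ⟨Φs, hΦs⟩ := Φ.exists_translate (-s)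
    have hEs : periodicEnergy v Φs = periodicEnergy v Φ := periodicEnergy_translate v Φ (-s) hΦs
    obtain ⟨c, hc, h⟩ := hR Φ Φs hΦR (hEs ▸ hΦR)
    refine ⟨c, hc, ?_⟩
    have hfun : ∀ X : Config (n + 1), Φs.ψ X = Φ.ψ (X + fun _ => s) := fun X => by
      rw [hΦs]
      show Φ.ψ (X - fun _ => -s) = Φ.ψ (X + fun _ => s)
      congr 1
      funext i
      simp [sub_eq_add_neg]
    simpa only [hfun] using h
  -- Step 3: the zero mode carries the top eigenvalue, and the top eigenvalue is `≥ N c_X`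
  have hmax := maxOccupation_indicator_le hL Φ hreal hrig
  have hΦm : Measurable ((cellN (n + 1) L).indicator Φ.ψ) :=
    Φ.contDiff.continuous.measurable.indicator (measurableSet_cellN _ _)
  have hΦ1 : ∫⁻ Z, (‖(cellN (n + 1) L).indicator Φ.ψ Z‖₊ : ℝ≥0∞) ^ 2 ≤ 1 := by
    rw [lintegral_indicator_sq, Φ.norm_eq]
  have hPO := succ_mul_swapPurity_le_maxOccupation hΦm hΦ1
  have hchain : ((n + 1 : ℕ) : ℝ≥0∞) * ENNReal.ofReal cX ≤
      (condensateOccupation (n + 1) L Φ.ψ ^ (1 / 2 : ℝ) +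
        ((n + 1 : ℕ) : ℝ≥0∞) ^ (1 / 2 : ℝ) * (ENNReal.ofReal η) ^ (1 / 2 : ℝ)) ^ 2 :=
    calc ((n + 1 : ℕ) : ℝ≥0∞) * ENNReal.ofReal cX
        ≤ ((n + 1 : ℕ) : ℝ≥0∞) * swapPurity n ((cellN (n + 1) L).indicator Φ.ψ) := by
          gcongr; exact hX Φ hΦX
      _ ≤ _ := hPO
      _ ≤ _ := hmax
  -- arithmetic in `ℝ`
  have hfin : condensateOccupation (n + 1) L Φ.ψ ≠ ⊤ :=
    condensateOccupation_ne_top_of_lintegral_le_one hL Φ.contDiff.continuous Φ.norm_eq.le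
  set t : ℝ := (condensateOccupation (n + 1) L Φ.ψ).toReal with ht
  have ht0 : 0 ≤ t := ENNReal.toReal_nonneg
  have hn₀ : condensateOccupation (n + 1) L Φ.ψ = ENNReal.ofReal t :=
    (ENNReal.ofReal_toReal hfin).symm
  have hη0 : 0 ≤ η := by positivity
  have hrhs : (condensateOccupation (n + 1) L Φ.ψ ^ (1 / 2 : ℝ) +
        ((n + 1 : ℕ) : ℝ≥0∞) ^ (1 / 2 : ℝ) * (ENNReal.ofReal η) ^ (1 / 2 : ℝ)) ^ 2 =
      ENNReal.ofReal ((Real.sqrt t + Real.sqrt ((n + 1 : ℕ) : ℝ) * Real.sqrt η) ^ 2) := by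
    rw [hn₀, ← ENNReal.ofReal_natCast, ofReal_rpow_half_eq_sqrt ht0,
      ofReal_rpow_half_eq_sqrt (Nat.cast_nonneg _), ofReal_rpow_half_eq_sqrt hη0,
      ← ENNReal.ofReal_mul (Real.sqrt_nonneg _), ← ENNReal.ofReal_add (Real.sqrt_nonneg _)
        (by positivity), ← ENNReal.ofReal_pow (by positivity)]
  have hlhs : ((n + 1 : ℕ) : ℝ≥0∞) * ENNReal.ofReal cX =
      ENNReal.ofReal (((n + 1 : ℕ) : ℝ) * cX) := by
    rw [ENNReal.ofReal_mul (Nat.cast_nonneg _), ENNReal.ofReal_natCast]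
  rw [hrhs, hlhs, ENNReal.ofReal_le_ofReal_iff (by positivity)] at hchain
  -- `√(N c_X) ≤ √t + √N √c_X/4`, hence `t ≥ (3/4)² N c_X ≥ N c_X/2`
  have hsqη : Real.sqrt η = Real.sqrt cX / 4 := Real.sqrt_sq (by positivity)
  have hab : Real.sqrt ((n + 1 : ℕ) : ℝ) * Real.sqrt cX ≤
      Real.sqrt t + Real.sqrt ((n + 1 : ℕ) : ℝ) * (Real.sqrt cX / 4) := by
    rw [← hsqη, ← Real.sqrt_mul (Nat.cast_nonneg _)]
    calc Real.sqrt (((n + 1 : ℕ) : ℝ) * cX)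
        ≤ Real.sqrt ((Real.sqrt t + Real.sqrt ((n + 1 : ℕ) : ℝ) * Real.sqrt η) ^ 2) :=
          Real.sqrt_le_sqrt hchain
      _ = Real.sqrt t + Real.sqrt ((n + 1 : ℕ) : ℝ) * Real.sqrt η := Real.sqrt_sq (by positivity)
  have hkey : cX / 2 * ((n + 1 : ℕ) : ℝ) ≤ t := by
    have h34 : 3 / 4 * (Real.sqrt ((n + 1 : ℕ) : ℝ) * Real.sqrt cX) ≤ Real.sqrt t := by linarith
    have hsq34 := mul_self_le_mul_self (by positivity) h34
    have hprod : ((n + 1 : ℕ) : ℝ) * cX = (Real.sqrt ((n + 1 : ℕ) : ℝ) * Real.sqrt cX) ^ 2 := by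
      rw [mul_pow, Real.sq_sqrt (Nat.cast_nonneg _), Real.sq_sqrt hcX.le]
    have htt : t = Real.sqrt t ^ 2 := (Real.sq_sqrt ht0).symm
    nlinarith [hsq34, hprod, htt]
  rw [hn₀]
  exact ENNReal.ofReal_le_ofReal hkey

/-- **The glue at fixed `N = n+1`**: swap bound + phase rigidity on the torus of side `L` give
`⟨Ψ, n₀Ψ⟩ ≥ N c_X/4` for EVERY `δ`-near-minimiser `Ψ`, for some `δ > 0` (steps 1–3 give a condensed
non-negative near-minimiser at every slack; clustering modulo a phase and the `2N`-Lipschitz bound on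
`n₀` transfer it, `le_condensateOccupation_nearMinimiser_of_clustering`).
[cite: PenroseOnsager1956, §4 (5)–(7)] -/
theorem exists_slack_condensateOccupation_ge {v : ℝ → ℝ≥0∞} (hv : Measurable v) {cX : ℝ}
    (hcX : 0 < cX)
    (hR : ∀ η : ℝ, 0 < η → ∃ δ : ℝ≥0∞, 0 < δ ∧ ∀ Ψ Φ : PeriodicTrialState (n + 1) L,
      periodicEnergy v Ψ ≤ periodicGroundStateEnergy v (n + 1) L + δ →
      periodicEnergy v Φ ≤ periodicGroundStateEnergy v (n + 1) L + δ →
      ∃ c : ℂ, ‖c‖ = 1 ∧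
        ∫⁻ X in cellN (n + 1) L, (‖Ψ.ψ X - c * Φ.ψ X‖₊ : ℝ≥0∞) ^ 2 ≤ ENNReal.ofReal η)
    (hX : ∃ δ : ℝ≥0∞, 0 < δ ∧ ∀ Ψ : PeriodicTrialState (n + 1) L,
      periodicEnergy v Ψ ≤ periodicGroundStateEnergy v (n + 1) L + δ →
      ENNReal.ofReal cX ≤ swapPurity n ((cellN (n + 1) L).indicator Ψ.ψ)) :
    ∃ δ : ℝ≥0∞, 0 < δ ∧ ∀ Ψ : PeriodicTrialState (n + 1) L,
      periodicEnergy v Ψ ≤ periodicGroundStateEnergy v (n + 1) L + δ →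
      ENNReal.ofReal (cX / 4 * ((n + 1 : ℕ) : ℝ)) ≤ condensateOccupation (n + 1) L Ψ.ψ := by
  by_cases hne : Nonempty (PeriodicTrialState (n + 1) L)
  swap
  · exact ⟨1, one_pos, fun Ψ _ => (hne ⟨Ψ⟩).elim⟩
  obtain ⟨Ψ₀⟩ := hne
  have hL : 0 < L := Ψ₀.side_pos
  -- clustering modulo a phase, in the Bochner form of `CondensateOccupationStability`
  have hcl : ∀ η : ℝ, 0 < η → ∃ δ : ℝ≥0∞, 0 < δ ∧ ∀ Φ Φ' : PeriodicTrialState (n + 1) L,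
      periodicEnergy v Φ ≤ periodicGroundStateEnergy v (n + 1) L + δ →
      periodicEnergy v Φ' ≤ periodicGroundStateEnergy v (n + 1) L + δ →
      ∃ θ : ℝ, ∫ X in cellN (n + 1) L,
        ‖Φ.ψ X - Complex.exp (θ * Complex.I) * Φ'.ψ X‖ ^ 2 ≤ η := by
    intro η hη
    obtain ⟨δ, hδ, h⟩ := hR η hη
    refine ⟨δ, hδ, fun Φ Φ' hΦ hΦ' => ?_⟩
    obtain ⟨c, hc, hcc⟩ := h Φ Φ' hΦ hΦ'
    refine ⟨Complex.arg c, ?_⟩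
    have hexp : Complex.exp (Complex.arg c * Complex.I) = c := by
      have := Complex.norm_mul_exp_arg_mul_I c
      rwa [hc, Complex.ofReal_one, one_mul] at this
    rw [hexp]
    have hcont : Continuous fun X => Φ.ψ X - c * Φ'.ψ X :=
      Φ.contDiff.continuous.sub (continuous_const.mul Φ'.contDiff.continuous)
    rw [lintegral_cellN_nnnorm_sq_eq_ofReal L hcont, ENNReal.ofReal_le_ofReal_iff hη.le] at hcc
    exact hcc
  -- a condensed near-minimiser at every slack
  obtain ⟨δR, hδR, hRR⟩ := hR ((Real.sqrt cX / 4) ^ 2) (by positivity)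
  obtain ⟨δX, hδX, hXX⟩ := hX
  have hocc : ∀ δ : ℝ≥0∞, 0 < δ → ∃ Ψ : PeriodicTrialState (n + 1) L,
      periodicEnergy v Ψ ≤ periodicGroundStateEnergy v (n + 1) L + δ ∧
      ENNReal.ofReal (cX / 2 * ((n + 1 : ℕ) : ℝ)) ≤ condensateOccupation (n + 1) L Ψ.ψ :=
    fun δ hδ => exists_nearMinimiser_condensateOccupation_ge hL hv hcX hδR hδX hRR hXX Ψ₀ hδ
  have h := le_condensateOccupation_nearMinimiser_of_clustering hL v hcl hocc
    (ε := cX / 4) (by positivity)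
  have h4 : cX / 2 - cX / 4 = cX / 4 := by ring
  rw [h4] at h
  exact h

end SwapToZeroMode

open SwapToZeroMode in
/-- **`SwapToZeroMode`** (closes stmt-AtomisticToContinuum-14397, exact route signature):
`TorusPhaseRigidity → TorusSwapBound → PeriodicBEC` — on the torus of side `(N/ρ)^{1/3}`, a uniform
swap-purity floor `tr γ_Ψ²/N² ≥ c_X` for near-minimisers (mode-free condensation, Penrose–Onsager II)
together with fixed-`N` phase rigidity yields condensation in the CONSTANT mode, `⟨Ψ, n₀Ψ⟩ ≥ (c_X/4) N`
for all `δ`-near-minimisers, `δ` after `N`. Steps: non-negative near-minimiser (diamagnetic smoothing),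
translates are near-minimisers (`periodicEnergy_translate`) hence close modulo phase, translation
averages of occupations are bounded by `n₀` for positive states, occupation stability, P–O II
(`succ_mul_swapPurity_le_maxOccupation`), and the clustering transfer to all near-minimisers.
[cite: PenroseOnsager1956, §4 (5)–(7)] -/
theorem swapToZeroMode_proof :
    Summit.AtomisticToContinuum.BoseEinsteinCondensation.Theses.BECSwapNoCatastrophe.SwapToZeroMode := by
  intro hRig hSwap v hv
  obtain ⟨ρ₁, hρ₁, hR⟩ := hRig v hv
  obtain ⟨ρ₂, hρ₂, hS⟩ := hSwap v hv
  refine ⟨min ρ₁ ρ₂, lt_min hρ₁ hρ₂, fun ρ hρ hρlt => ?_⟩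
  have hρ1 : ρ < ρ₁ := hρlt.trans_le (min_le_left _ _)
  have hρ2 : ρ < ρ₂ := hρlt.trans_le (min_le_right _ _)
  obtain ⟨cX, hcX, hSev⟩ := hS ρ hρ hρ2
  have hRev' := (tendsto_add_atTop_nat 1).eventually (hR ρ hρ hρ1)
  refine ⟨cX / 4, by positivity, ?_⟩
  have key : ∀ᶠ n : ℕ in atTop, ∃ δ : ℝ≥0∞, 0 < δ ∧
      ∀ Ψ : PeriodicTrialState (n + 1) (sideLength ρ (n + 1)),
        periodicEnergy v Ψ ≤ periodicGroundStateEnergy v (n + 1) (sideLength ρ (n + 1)) + δ →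
        ENNReal.ofReal (cX / 4 * ((n + 1 : ℕ) : ℝ)) ≤
          condensateOccupation (n + 1) (sideLength ρ (n + 1)) Ψ.ψ := by
    filter_upwards [hRev', hSev] with n hRn hSn
    exact exists_slack_condensateOccupation_ge hv.1 hcX hRn hSn
  rw [Filter.eventually_atTop] at key ⊢
  obtain ⟨n₀, hn₀⟩ := key
  refine ⟨n₀ + 1, fun N hN => ?_⟩
  obtain ⟨m, rfl⟩ := Nat.exists_eq_succ_of_ne_zero (by omega : N ≠ 0)
  exact hn₀ m (by omega)

end Summit.AtomisticToContinuum.BoseEinsteinCondensation.Theorems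

end
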